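import Literature.MathematicalPhysics.QuantumLattice.StabilityCoreAdapterProofs
import Literature.MathematicalPhysics.QuantumLattice.QuasiLocalPiecesProofs
import HarnessLib

/-!
# MZ13 Proposition 1, step 1: the rotated Hamiltonian as a sum of `P₀`-commuting term groups

Top-down layer (seat B) of the formalisation of the Michalakis–Zwolak stability theorem
(hubbard.S19, `Literature.MathematicalPhysics.QuantumLattice.michalakis_zwolak`). Michalakis–Zwolak,
arXiv:1109.1588 §5.2, first step of the transformation and proof of Proposition 1 (pp. 11–12):
"We transform the terms `𝓕^s(Q_u) + s 𝓕^s(V_u)` of `H_s = Σ_u 𝓕^s(Q_u + sV_u)`, satisfying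
`[𝓕^s(·), P₀(s)] = 0`, into terms `X_u = U†(s) 𝓕^s(Q_u + sV_u) U(s) − 𝓕⁰(Q_u)` satisfying
`[X_u, P₀] = U†(s)[𝓕^s(·), P₀(s)]U(s) − [𝓕⁰(Q_u), P₀] = 0`, where the unitary `U(s)` satisfies
`U(s) P₀ U†(s) = P₀(s)`. At this point … `H'_s := U†(s) H_s U(s) = H₀ + Σ_u X_u`."

This file proves exactly this algebra, at fixed volume, in the term-wise format of
`michalakis_zwolak_of_termwise_core` (`exists_termwise_of_flow_decomposition`): given

* a unitary `U` and a projection `P_s` with `U⋆ P_s U = P₀` (the spectral flow),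
* additive, homogeneous "smoothing" maps `F_s`, `F₀ : Op → Op` with `F_s(H_s) = H_s`,
  `F₀(H₀) = H₀`, `[F_s(O), P_s] = 0`, `[F₀(O), P₀] = 0` (MZ13 Lemma 1 (i)–(ii)),
* for every term `Φ Z ≠ 0` a decomposition of `U⋆ F_s(Φ Z) U − F₀(Φ Z)` and for every
  `V Z ≠ 0` one of `U⋆ F_s(V Z) U` into Hermitian pieces supported on the balls
  `cellBall (c Z) ℓ`, `ℓ ≤ L`, about provider-chosen centres with `Z ⊆ cellBall (c Z) r₀`
  (resp. `r`), with bounds `|ε| B_p/(ℓ+1)^p` (resp. `B_p/(ℓ+1)^p`) — the analytic content of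
  MZ13 Lemma 1 (v) and Lemma 2,

the groups `G = {Z | Φ Z ≠ 0} ⊕ {Z | V Z ≠ 0}` with pieces `A Z ℓ` and `(sε) B Z ℓ` satisfy
`U⋆ H_s U = H₀ + Σ_g Σ_ℓ Y g ℓ`, per-group commutation with `P₀`, the bounds `|ε| B_p/(ℓ+1)^p`,
and centre multiplicity `≤ 2^{(2r₀+1)^d |κ|} + 2^{(2r+1)^d |κ|}` (ball counting,
`card_cellBall_le` of `QuasiLocalPiecesProofs`). The wrapper
`michalakis_zwolak_of_flow_decomposition_core` states the resulting reduction of the named fact.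
No definitions, no named facts (theorems only).
-/

noncomputable section

open Matrix Finset Module
open scoped InnerProductSpace ComplexOrder Matrix.Norms.L2Operator

namespace Literature.MathematicalPhysics.QuantumLattice

open Literature.Probability.LatticeModels

/-! ### Additive maps over finite sums; conjugated commutators -/

section Algebra

variable {n : Type*} [Fintype n] [DecidableEq n]

omit [Fintype n] [DecidableEq n] in
/-- An additive, homogeneous map on matrices is additive over finite sums. [folklore] -/
theorem map_finset_sum_of_add {F : Matrix n n ℂ → Matrix n n ℂ}
    (hadd : ∀ A B, F (A + B) = F A + F B) (hsmul : ∀ (a : ℂ) A, F (a • A) = a • F A)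
    {ι : Type*} (s : Finset ι) (f : ι → Matrix n n ℂ) :
    F (∑ i ∈ s, f i) = ∑ i ∈ s, F (f i) := by
  classical
  have h0 : F 0 = 0 := by simpa using hsmul 0 0
  induction s using Finset.induction_on with
  | empty => simp [h0]
  | insert i s hi ih => rw [sum_insert hi, sum_insert hi, hadd, ih]

/-- Conjugation transports commutation: if `[F, P_s] = 0` and `U⋆ P_s U = P₀` with `U` unitary,
then `[U⋆ F U, P₀] = 0`. MZ13 p. 11: "`[X_u, P₀] = U†(s)[𝓕^s(·), P₀(s)]U(s) … = 0`".
[cite: MichalakisZwolakCMP2013, §5.2 (arXiv:1109.1588 p. 11)] -/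
theorem commute_conj_of_commute {U F Ps P₀ : Matrix n n ℂ} (hU : U ∈ unitary (Matrix n n ℂ))
    (hUP : star U * Ps * U = P₀) (hc : Commute F Ps) : Commute (star U * F * U) P₀ := by
  have h1 : U * star U = 1 := Unitary.mul_star_self_of_mem hU
  rw [← hUP]
  change star U * F * U * (star U * Ps * U) = star U * Ps * U * (star U * F * U)
  calc star U * F * U * (star U * Ps * U)
      = star U * F * (U * star U) * Ps * U := by simp only [Matrix.mul_assoc]
    _ = star U * (F * Ps) * U := by rw [h1, Matrix.mul_one, Matrix.mul_assoc (star U)]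
    _ = star U * (Ps * F) * U := by rw [hc.eq]
    _ = star U * Ps * (U * star U) * F * U := by
        rw [h1, Matrix.mul_one]; simp only [Matrix.mul_assoc]
    _ = star U * Ps * U * (star U * F * U) := by simp only [Matrix.mul_assoc]

end Algebra

/-! ### The term-wise data from the flow decomposition -/

section Volume

universe u

variable {d L : ℕ} [NeZero L] {κ : Type u} [Fintype κ] [DecidableEq κ] {q : ℕ}

omit [DecidableEq κ] in
/-- Regions inside a fixed ball with a given property number at most `2^{|ball|}`. [folklore] -/
theorem card_filter_subset_le_two_pow (u : TorusSite d L) (r : ℕ)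
    (S : Finset (Finset (TorusSite d L × κ))) (hS : ∀ Z ∈ S, Z ⊆ cellBall u r) :
    S.card ≤ 2 ^ ((2 * r + 1) ^ d * Fintype.card κ) := by
  calc S.card ≤ ((cellBall u r : Finset (TorusSite d L × κ)).powerset).card :=
        card_le_card fun Z hZ => mem_powerset.mpr (hS Z hZ)
    _ = 2 ^ (cellBall u r : Finset (TorusSite d L × κ)).card := card_powerset _
    _ ≤ 2 ^ ((2 * r + 1) ^ d * Fintype.card κ) := Nat.pow_le_pow_right (by norm_num) (card_cellBall_le u r)

/-- **MZ13 Proposition 1, step 1 (term-wise, fixed volume).** See the module docstring.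
[cite: MichalakisZwolakCMP2013, §5.2 Prop. 1 step 1 (arXiv:1109.1588 pp. 11–12)] -/
theorem exists_termwise_of_flow_decomposition {Φ V : Interaction (TorusSite d L × κ) q}
    (r₀ r : ℕ) (c₁ c₂ : Finset (TorusSite d L × κ) → TorusSite d L)
    (hc₁ : ∀ Z, Φ Z ≠ 0 → Z ⊆ cellBall (c₁ Z) r₀) (hc₂ : ∀ Z, V Z ≠ 0 → Z ⊆ cellBall (c₂ Z) r)
    {κs : ℂ} {Ps P₀ U : Op (TorusSite d L × κ) q} (hU : U ∈ unitary (Op (TorusSite d L × κ) q))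
    (hUP : star U * Ps * U = P₀)
    (Fs F0 : Op (TorusSite d L × κ) q → Op (TorusSite d L × κ) q)
    (hFs_add : ∀ A B, Fs (A + B) = Fs A + Fs B) (hFs_smul : ∀ (a : ℂ) A, Fs (a • A) = a • Fs A)
    (hFs_H : Fs (∑ Z, Φ Z + κs • ∑ Z, V Z) = ∑ Z, Φ Z + κs • ∑ Z, V Z)
    (hFs_comm : ∀ O, Commute (Fs O) Ps)
    (hF0_add : ∀ A B, F0 (A + B) = F0 A + F0 B) (hF0_smul : ∀ (a : ℂ) A, F0 (a • A) = a • F0 A)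
    (hF0_H : F0 (∑ Z, Φ Z) = ∑ Z, Φ Z) (hF0_comm : ∀ O, Commute (F0 O) P₀)
    (A B : Finset (TorusSite d L × κ) → ℕ → Op (TorusSite d L × κ) q)
    (hAsum : ∀ Z, Φ Z ≠ 0 → ∑ ℓ ∈ range (L + 1), A Z ℓ = star U * Fs (Φ Z) * U - F0 (Φ Z))
    (hBsum : ∀ Z, V Z ≠ 0 → ∑ ℓ ∈ range (L + 1), B Z ℓ = star U * Fs (V Z) * U)
    (hAs : ∀ Z ℓ, IsSupportedOn (A Z ℓ) (cellBall (c₁ Z) ℓ))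
    (hBs : ∀ Z ℓ, IsSupportedOn (B Z ℓ) (cellBall (c₂ Z) ℓ))
    (hAh : ∀ Z ℓ, (A Z ℓ).IsHermitian) (hBh : ∀ Z ℓ, (B Z ℓ).IsHermitian) (hκs : star κs = κs)
    {ε : ℝ} (hκε : ‖κs‖ ≤ |ε|) {Bd : ℕ → ℝ}
    (hAn : ∀ Z ℓ (p : ℕ), ‖A Z ℓ‖ ≤ |ε| * (Bd p / ((ℓ : ℝ) + 1) ^ p))
    (hBn : ∀ Z ℓ (p : ℕ), ‖B Z ℓ‖ ≤ Bd p / ((ℓ : ℝ) + 1) ^ p) :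
    ∃ (G : Type u) (_ : Fintype G) (c : G → TorusSite d L)
      (Y : G → ℕ → Op (TorusSite d L × κ) q),
      star U * (∑ Z, Φ Z + κs • ∑ Z, V Z) * U = ∑ Z, Φ Z + ∑ g, ∑ ℓ ∈ range (L + 1), Y g ℓ ∧
      (∀ g ℓ, IsSupportedOn (Y g ℓ) (cellBall (c g) ℓ)) ∧
      (∀ g ℓ, (Y g ℓ).IsHermitian) ∧
      (∀ g, Commute (∑ ℓ ∈ range (L + 1), Y g ℓ) P₀) ∧
      (∀ g ℓ (p : ℕ), ‖Y g ℓ‖ ≤ |ε| * (Bd p / ((ℓ : ℝ) + 1) ^ p)) ∧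
      (∀ u, (univ.filter fun g => c g = u).card ≤
        2 ^ ((2 * r₀ + 1) ^ d * Fintype.card κ) + 2 ^ ((2 * r + 1) ^ d * Fintype.card κ)) := by
  classical
  set SΦ : Finset (Finset (TorusSite d L × κ)) := univ.filter fun Z => Φ Z ≠ 0 with hSΦ
  set SV : Finset (Finset (TorusSite d L × κ)) := univ.filter fun Z => V Z ≠ 0 with hSV
  refine ⟨↥SΦ ⊕ ↥SV, inferInstance, Sum.elim (fun Z => c₁ Z) (fun Z => c₂ Z),
    Sum.elim (fun Z ℓ => A Z ℓ) (fun Z ℓ => κs • B Z ℓ), ?_, ?_, ?_, ?_, ?_, ?_⟩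
  -- (1) the identity
  · have hFs0 : Fs 0 = 0 := by simpa using hFs_smul 0 0
    have hF00 : F0 0 = 0 := by simpa using hF0_smul 0 0
    -- expand `U⋆ H_s U` and `H₀` through the smoothing maps
    have h1 : star U * (∑ Z, Φ Z + κs • ∑ Z, V Z) * U =
        ∑ Z, star U * Fs (Φ Z) * U + κs • ∑ Z, star U * Fs (V Z) * U := by
      conv_lhs => rw [← hFs_H]
      rw [hFs_add, hFs_smul, map_finset_sum_of_add hFs_add hFs_smul,
        map_finset_sum_of_add hFs_add hFs_smul, Matrix.mul_add, Matrix.add_mul, Matrix.mul_smul,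
        Matrix.smul_mul, Finset.mul_sum, Finset.sum_mul, Finset.mul_sum, Finset.sum_mul]
    have h2 : (∑ Z, Φ Z : Op (TorusSite d L × κ) q) = ∑ Z, F0 (Φ Z) := by
      conv_lhs => rw [← hF0_H]
      exact map_finset_sum_of_add hF0_add hF0_smul _ _
    -- restrict to the non-zero terms
    have h3 : ∑ Z, (star U * Fs (Φ Z) * U - F0 (Φ Z)) = ∑ Z ∈ SΦ, ∑ ℓ ∈ range (L + 1), A Z ℓ := by
      rw [← sum_filter_add_sum_filter_not univ (fun Z => Φ Z ≠ 0)]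
      have hz : ∑ Z ∈ univ.filter (fun Z => ¬ Φ Z ≠ 0), (star U * Fs (Φ Z) * U - F0 (Φ Z)) = 0 :=
        sum_eq_zero fun Z hZ => by
          have h0 : Φ Z = 0 := not_not.mp (mem_filter.mp hZ).2
          rw [h0, hFs0, hF00, Matrix.mul_zero, Matrix.zero_mul, sub_zero]
      rw [hz, add_zero]
      exact sum_congr rfl fun Z hZ => (hAsum Z (mem_filter.mp hZ).2).symm
    have h4 : ∑ Z, star U * Fs (V Z) * U = ∑ Z ∈ SV, ∑ ℓ ∈ range (L + 1), B Z ℓ := by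
      rw [← sum_filter_add_sum_filter_not univ (fun Z => V Z ≠ 0)]
      have hz : ∑ Z ∈ univ.filter (fun Z => ¬ V Z ≠ 0), star U * Fs (V Z) * U = 0 :=
        sum_eq_zero fun Z hZ => by
          have h0 : V Z = 0 := not_not.mp (mem_filter.mp hZ).2
          rw [h0, hFs0, Matrix.mul_zero, Matrix.zero_mul]
      rw [hz, add_zero]
      exact sum_congr rfl fun Z hZ => (hBsum Z (mem_filter.mp hZ).2).symm
    rw [h1, Fintype.sum_sum_type]
    simp only [Sum.elim_inl, Sum.elim_inr]
    rw [← Finset.sum_coe_sort SΦ (fun Z => ∑ ℓ ∈ range (L + 1), A Z ℓ)] at h3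
    rw [← Finset.sum_coe_sort SV (fun Z => ∑ ℓ ∈ range (L + 1), B Z ℓ)] at h4
    have h5 : ∑ Z : ↥SV, ∑ ℓ ∈ range (L + 1), κs • B Z ℓ = κs • ∑ Z : ↥SV, ∑ ℓ ∈ range (L + 1), B Z ℓ := by
      rw [Finset.smul_sum]
      exact sum_congr rfl fun Z _ => (Finset.smul_sum).symm
    rw [h5, ← h4, ← h3, sum_sub_distrib, ← h2]
    abel
  -- (2) supports
  · rintro (Z | Z) ℓ
    · exact hAs Z ℓ
    · exact (hBs Z ℓ).smul κs
  -- (3) hermiticity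
  · rintro (Z | Z) ℓ
    · exact hAh Z ℓ
    · change (κs • B Z ℓ).IsHermitian
      rw [IsHermitian, conjTranspose_smul, (hBh Z ℓ).eq, hκs]
  -- (4) commutation per group
  · rintro (Z | Z)
    · change Commute (∑ ℓ ∈ range (L + 1), A Z ℓ) P₀
      rw [hAsum Z (mem_filter.mp Z.2).2]
      exact (commute_conj_of_commute hU hUP (hFs_comm _)).sub_left (hF0_comm _)
    · change Commute (∑ ℓ ∈ range (L + 1), κs • B Z ℓ) P₀
      rw [← Finset.smul_sum, hBsum Z (mem_filter.mp Z.2).2]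
      exact (commute_conj_of_commute hU hUP (hFs_comm _)).smul_left κs
  -- (5) norms
  · rintro (Z | Z) ℓ p
    · exact hAn Z ℓ p
    · change ‖κs • B Z ℓ‖ ≤ _
      have h0 : 0 ≤ Bd p / ((ℓ : ℝ) + 1) ^ p := (norm_nonneg _).trans (hBn Z ℓ p)
      rw [norm_smul]
      exact mul_le_mul hκε (hBn Z ℓ p) (norm_nonneg _) (abs_nonneg ε)
  -- (6) multiplicity of the centres
  · intro u
    set uS := univ.filter fun g : ↥SΦ ⊕ ↥SV =>
      Sum.elim (fun Z : ↥SΦ => c₁ Z) (fun Z : ↥SV => c₂ Z) g = u with huS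
    rw [← Finset.card_toLeft_add_card_toRight]
    refine Nat.add_le_add ?_ ?_
    · calc uS.toLeft.card ≤ (SΦ.filter fun Z => c₁ Z = u).card := by
            refine card_le_card_of_injOn (fun Z => (Z : Finset (TorusSite d L × κ))) ?_ ?_
            · intro Z hZ
              have hZ' : c₁ Z = u := by
                have := (Finset.mem_toLeft.mp hZ)
                simpa [huS] using this
              simp only [coe_filter, Set.mem_setOf_eq]
              exact ⟨Z.2, hZ'⟩
            · intro Z _ Z' _ h
              exact Subtype.ext h
        _ ≤ 2 ^ ((2 * r₀ + 1) ^ d * Fintype.card κ) := by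
            refine card_filter_subset_le_two_pow u r₀ _ fun Z hZ => ?_
            obtain ⟨hZ1, hZ2⟩ := mem_filter.mp hZ
            rw [← hZ2]
            exact hc₁ Z (mem_filter.mp hZ1).2
    · calc uS.toRight.card ≤ (SV.filter fun Z => c₂ Z = u).card := by
            refine card_le_card_of_injOn (fun Z => (Z : Finset (TorusSite d L × κ))) ?_ ?_
            · intro Z hZ
              have hZ' : c₂ Z = u := by
                have := (Finset.mem_toRight.mp hZ)
                simpa [huS] using this
              simp only [coe_filter, Set.mem_setOf_eq]
              exact ⟨Z.2, hZ'⟩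
            · intro Z _ Z' _ h
              exact Subtype.ext h
        _ ≤ 2 ^ ((2 * r + 1) ^ d * Fintype.card κ) := by
            refine card_filter_subset_le_two_pow u r _ fun Z hZ => ?_
            obtain ⟨hZ1, hZ2⟩ := mem_filter.mp hZ
            rw [← hZ2]
            exact hc₂ Z (mem_filter.mp hZ1).2

/-- **The unperturbed cluster projection is the ground-state projection.** For a projector
interaction with the Local-Gap condition (non-empty configuration space), the spectral projection
of `H₀ = H_univ` onto the eigenvalues `≤ a`, `0 ≤ a < γloc L`, in the eigenvector-span form used
by the spectral-flow layers (`hasDerivAt_clusterProj`: `projMatrix (span {uₖ | λₖ ≤ a'})`), is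
`localGroundProj Φ univ = P₀`: the eigenvalues are `0` (on the kernel) or `≥ γloc L`. This is the
identification `P_Λ(ε) = P₀` for `0 ≤ ε ≤ γ` of MZ13 Corollary 1 (2) (arXiv:1109.1588 p. 7),
needed to read the intertwining `U(s)ᴴ P(s) U(s) = P(0)` of the flow as `U⋆ P_s U = P₀`.
[cite: MichalakisZwolakCMP2013, §4 Corollary 1 (2) (arXiv:1109.1588 p. 7)] -/
theorem localGroundProj_univ_eq_projMatrix_span [Nonempty (TensorIndex (TorusSite d L × κ) q)]
    {Φ : Interaction (TorusSite d L × κ) q} (hΦ : IsProjectorInteraction Φ) {γloc : ℕ → ℝ}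
    (hloc : HasLocalGap Φ γloc) (hH : (localHamiltonian Φ univ).IsHermitian) {a : ℝ}
    (ha0 : 0 ≤ a) (haγ : a < γloc L) :
    localGroundProj Φ univ = projMatrix (Submodule.span ℂ (Set.range fun i :
      ({k | hH.eigenvalues k ≤ a} : Finset (TensorIndex (TorusSite d L × κ) q)) =>
        hH.eigenvectorBasis i)) := by
  -- the Local-Gap condition at the ball `cellBall x₀ L = univ`
  have x₀ : TorusSite d L := fun _ => 0
  have hg := hloc x₀ L
  rw [cellBall_side x₀] at hg
  have hE0 : (⨅ j, hH.eigenvalues j) = 0 := hΦ.iInf_eigenvalues_eq_zero hg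
  have hnn : ∀ i, 0 ≤ hH.eigenvalues i := (hΦ.posSemidef_localHamiltonian univ).eigenvalues_nonneg
  obtain ⟨_, -, -, -, hsep⟩ := hg
  -- the index sets `{λ ≤ a}` and `{λ = 0}` agree
  have hset : ({k | hH.eigenvalues k ≤ a} : Finset (TensorIndex (TorusSite d L × κ) q)) =
      ({k | hH.eigenvalues k = 0} : Finset (TensorIndex (TorusSite d L × κ) q)) := by
    ext k
    simp only [Finset.mem_filter, Finset.mem_univ, true_and]
    constructor
    · intro hk
      rcases hsep k with h | h
      · rw [hE0, add_zero] at h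
        exact le_antisymm h (hnn k)
      · rw [hE0, zero_add, zero_add] at h
        exact absurd (h.trans hk) (not_le.mpr haγ)
    · intro hk
      rw [hk]
      exact ha0
  rw [hset, ← eigenspace_toEuclideanLin_eq_span hH 0, Complex.ofReal_zero,
    ← hΦ.map_localGroundSpace_eq_eigenspace univ]
  rfl

end Volume

/-! ### The named fact from the flow-decomposition core -/

section Core

universe u

variable (d q : ℕ) {κ : Type u} [Fintype κ] [DecidableEq κ]

/-- The whole-lattice Hamiltonian is the sum of all terms. [folklore] -/
theorem localHamiltonian_univ_eq_sum {Λ : Type*} [Fintype Λ] [DecidableEq Λ] {q : ℕ}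
    (Φ : Interaction Λ q) : localHamiltonian Φ univ = ∑ Z, Φ Z := by
  simp [localHamiltonian, powerset_univ]

/-- **`michalakis_zwolak` from the flow-decomposition core (MZ13 Lemma 1, Lemma 2 and the
spectral flow).** The hypothesis `hF` asks, for the data of the named fact and for `|ε| ≤ 1`,
`L ≥ L_A`, `s ∈ [0, 1]` with the `γ/2`-gap along `[0, s]`: a unitary `U` and a projection `P_s`
with `U⋆ P_s U = P₀` (Hastings' spectral flow, `exists_unitary_flow` with `hasDerivAt_clusterProj`);
additive homogeneous maps `F_s`, `F₀` fixing `H_s = Σ_Z Φ Z + (sε) Σ_Z V Z` resp. `H₀` and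
commuting their images with `P_s` resp. `P₀` (the smoothing maps `∫ w τ_t^{H_s}` and
`∫ w τ_t^{H₀}` of MZ13 Lemma 1 (i)–(ii), `SpectralSmoothingProofs`); and, term by term, Hermitian
quasi-local decompositions of `U⋆ F_s(Φ Z) U − F₀(Φ Z)` (bounded by `|ε| B_p/(ℓ+1)^p`) and of
`U⋆ F_s(V Z) U` (bounded by `B_p/(ℓ+1)^p`) on the balls about centres containing the terms
(MZ13 Lemma 1 (v), Lemma 2, `SmoothingLocalityProofs`, `FlowLiebRobinsonProofs`). Everything
else is proved. [cite: MichalakisZwolakCMP2013, Thm. 1, §5 (arXiv:1109.1588 pp. 6–13)] -/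
theorem michalakis_zwolak_of_flow_decomposition_core
    (hF : ∀ (Φ : (L : ℕ) → Interaction (TorusSite d L × κ) q) (m : ℕ → ℕ) (γ : ℝ) (r₀ : ℕ)
      (Δ γloc : ℕ → ℝ),
      (∀ (L : ℕ) [NeZero L], IsProjectorInteraction (Φ L) ∧ (Φ L).IsLocal) →
      (∀ (L : ℕ) [NeZero L], IsFrustrationFree (Φ L) univ) →
      (∀ (L : ℕ) [NeZero L] (X : Finset (TorusSite d L × κ)), r₀ < torusDiam X → Φ L X = 0) →
      (0 < γ ∧ ∀ (L : ℕ) [NeZero L], (localHamiltonian (Φ L) univ).HasClusterGap (m L) 0 γ) →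
      HasUniformLTQO Φ Δ → HasFastDecay Δ → HasUniformLocalGap Φ γloc →
      (∃ c : ℝ, ∃ p : ℕ, 0 < c ∧ ∀ ℓ : ℕ, c / ((ℓ : ℝ) + 1) ^ p ≤ γloc ℓ) →
      ∀ (r : ℕ) (V : (L : ℕ) → Interaction (TorusSite d L × κ) q),
        (∀ (L : ℕ) [NeZero L], (V L).IsLocal ∧
          (∀ X, r < torusDiam X → V L X = 0) ∧ ∀ X, ‖V L X‖ ≤ 1) →
        ∃ L_A : ℕ, ∃ Bd : ℕ → ℝ,
          ∀ ε : ℝ, |ε| ≤ 1 → ∀ (L : ℕ) [NeZero L], L_A ≤ L → ∀ s ∈ Set.Icc (0 : ℝ) 1,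
            (∀ t ∈ Set.Icc (0 : ℝ) s, ∃ ω : ℝ, ω ≤ γ ∧
              (localHamiltonian (Φ L) univ +
                (t : ℂ) • ((ε : ℂ) • localHamiltonian (V L) univ)).HasClusterGap (m L) ω (γ / 2)) →
            ∃ (U Ps : Op (TorusSite d L × κ) q)
              (Fs F0 : Op (TorusSite d L × κ) q → Op (TorusSite d L × κ) q)
              (c₁ c₂ : Finset (TorusSite d L × κ) → TorusSite d L)
              (A B : Finset (TorusSite d L × κ) → ℕ → Op (TorusSite d L × κ) q),
              U ∈ unitary (Op (TorusSite d L × κ) q) ∧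
              star U * Ps * U = localGroundProj (Φ L) univ ∧
              (∀ X Y, Fs (X + Y) = Fs X + Fs Y) ∧ (∀ (a : ℂ) X, Fs (a • X) = a • Fs X) ∧
              Fs (∑ Z, Φ L Z + ((s * ε : ℝ) : ℂ) • ∑ Z, V L Z) =
                ∑ Z, Φ L Z + ((s * ε : ℝ) : ℂ) • ∑ Z, V L Z ∧
              (∀ O, Commute (Fs O) Ps) ∧
              (∀ X Y, F0 (X + Y) = F0 X + F0 Y) ∧ (∀ (a : ℂ) X, F0 (a • X) = a • F0 X) ∧
              F0 (∑ Z, Φ L Z) = ∑ Z, Φ L Z ∧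
              (∀ O, Commute (F0 O) (localGroundProj (Φ L) univ)) ∧
              (∀ Z, Φ L Z ≠ 0 → Z ⊆ cellBall (c₁ Z) r₀) ∧
              (∀ Z, V L Z ≠ 0 → Z ⊆ cellBall (c₂ Z) r) ∧
              (∀ Z, Φ L Z ≠ 0 →
                ∑ ℓ ∈ range (L + 1), A Z ℓ = star U * Fs (Φ L Z) * U - F0 (Φ L Z)) ∧
              (∀ Z, V L Z ≠ 0 → ∑ ℓ ∈ range (L + 1), B Z ℓ = star U * Fs (V L Z) * U) ∧
              (∀ Z ℓ, IsSupportedOn (A Z ℓ) (cellBall (c₁ Z) ℓ)) ∧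
              (∀ Z ℓ, IsSupportedOn (B Z ℓ) (cellBall (c₂ Z) ℓ)) ∧
              (∀ Z ℓ, (A Z ℓ).IsHermitian) ∧ (∀ Z ℓ, (B Z ℓ).IsHermitian) ∧
              (∀ Z ℓ (p : ℕ), ‖A Z ℓ‖ ≤ |ε| * (Bd p / ((ℓ : ℝ) + 1) ^ p)) ∧
              (∀ Z ℓ (p : ℕ), ‖B Z ℓ‖ ≤ Bd p / ((ℓ : ℝ) + 1) ^ p)) :
    michalakis_zwolak (κ := κ) d q := by
  refine michalakis_zwolak_of_termwise_core d q ?_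
  intro Φ m γ r₀ Δ γloc hproj hff hrange hgap hltqo hΔ hloc hγloc r V hV
  obtain ⟨L_A, Bd, h⟩ := hF Φ m γ r₀ Δ γloc hproj hff hrange hgap hltqo hΔ hloc hγloc r V hV
  refine ⟨L_A, 2 ^ ((2 * r₀ + 1) ^ d * Fintype.card κ) + 2 ^ ((2 * r + 1) ^ d * Fintype.card κ),
    Bd, ?_⟩
  intro ε hε L _ hL s hs hprev
  obtain ⟨U, Ps, Fs, F0, c₁, c₂, A, B, hU, hUP, hFs_add, hFs_smul, hFs_H, hFs_comm, hF0_add,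
    hF0_smul, hF0_H, hF0_comm, hc₁, hc₂, hAsum, hBsum, hAs, hBs, hAh, hBh, hAn, hBn⟩ :=
    h ε hε L hL s hs hprev
  have hHs : localHamiltonian (Φ L) univ + (s : ℂ) • ((ε : ℂ) • localHamiltonian (V L) univ) =
      ∑ Z, Φ L Z + ((s * ε : ℝ) : ℂ) • ∑ Z, V L Z := by
    rw [localHamiltonian_univ_eq_sum, localHamiltonian_univ_eq_sum, smul_smul, ← Complex.ofReal_mul]
  have hκs : star (((s * ε : ℝ) : ℂ)) = ((s * ε : ℝ) : ℂ) := Complex.conj_ofReal _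
  have hκε : ‖(((s * ε : ℝ) : ℂ))‖ ≤ |ε| := by
    rw [Complex.norm_real, Real.norm_eq_abs, abs_mul]
    have hs1 : |s| ≤ 1 := abs_le.mpr ⟨by linarith [hs.1], hs.2⟩
    exact mul_le_of_le_one_left (abs_nonneg ε) hs1
  obtain ⟨G, instG, c, Y, hid, hYs, hYh, hYc, hYn, hN⟩ :=
    exists_termwise_of_flow_decomposition r₀ r c₁ c₂ hc₁ hc₂ hU hUP Fs F0 hFs_add hFs_smul hFs_H
      hFs_comm hF0_add hF0_smul hF0_H hF0_comm A B hAsum hBsum hAs hBs hAh hBh hκs hκε hAn hBn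
  refine ⟨U, G, instG, c, Y, hU, ?_, hYs, hYh, hYc, hYn, hN⟩
  rw [hHs, hid, localHamiltonian_univ_eq_sum]

end Core

end Literature.MathematicalPhysics.QuantumLattice
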